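import Literature.AlgebraicGeometry.Modules.CechFullToOrdered
import Literature.Algebra.Homology.ExtOfAcyclicResolutionFunctoriality
import HarnessLib

/-!
# The restriction `res : Č•(𝓤, M) → Č•_ord(𝓤, M)` is injective on cohomology — elementwise form
# (The Stacks Project, Tags 01FG, 01FM)

Topic `AlgebraicGeometry/Modules`; namespace `Literature.AlgebraicGeometry.Modules.CechOrd`.  PROOF file (theorems only;
no definition, no named fact, no instance, no notation, no `sorry`).  Cell `hodgecm-mathlib` FLOOR 0, P1 sub-line F-11,
packet (iv)∕J3, brick **(T3) elementwise** = HOWTO (b) of F0P1b-p01 (g0) for F0P1b-p02∕p04 (g0).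

★ `CechOrd.homologyMap_resOfFull_bijective` (`Modules/CechFullToOrdered`) says that for a finite affine-faced cover `𝓤` of a
scheme `X` and an affine-localizing `𝒪_X`-module `M` the restriction `res` from the full to the ordered sheaf Čech complex
induces a bijection `Hⁿ⁺¹(Γ(X, Č•(𝓤, M))) → Hⁿ⁺¹(Γ(X, Č•_ord(𝓤, M)))`.  Here the INJECTIVITY half is unfolded to cochains:

* `homTopAddEquiv_resOfFull` — under the dictionaries ★ `Cech.homTopAddEquiv` ∕ ★ `CechOrd.homTopAddEquiv`
  (`Ext⁰(𝒪_X, Čⁿ) ≃+ Π_α Γ(M, X ∩ U_α)`) the map `Hom(𝒪_X, res)` is `res` on cochains;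
* **`exists_dSections_eq_of_resOfFull_eq_d`** — a full Čech cocycle `c ∈ Π_α Γ(M, U_α)` (`α : Fin (n+2) → ι`) whose
  restriction to increasing tuples is an ordered coboundary, `res c = d g`, is a full coboundary: `c = d w`.

Method: Mathlib's concrete `ker ⧸ Im` description of the homology of a complex of abelian groups
(`homologyIsoSc' ≪≫ abHomologyIso`) and ★ `AcyclicResolution.homologyMap_concreteOf` (the homology map is `kerQuotMapOf`).

## References
* The Stacks Project, Tags 01FG, 01FM. [StacksProject]
* C. A. Weibel, *An introduction to homological algebra* (1994), §1.1. [Weibel1994]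
-/

noncomputable section

universe w u

open CategoryTheory CategoryTheory.Abelian CategoryTheory.Limits Opposite TopologicalSpace AlgebraicGeometry
open Literature.Algebra.Homology

namespace Literature.AlgebraicGeometry.Modules

namespace CechOrd

variable {X : Scheme.{u}} {ι : Type u} [LinearOrder ι] [Fintype ι] (U : ι → X.Opens) (M : X.Modules)
variable [HasExt.{w} X.Modules]

/-- **`Hom(𝒪_X, res)` is `res` on cochains**: under the dictionaries `Ext⁰(𝒪_X, Čⁿ(𝓤, M)) ≃+ Π_α Γ(M, X ∩ U_α)` and
`Ext⁰(𝒪_X, Čⁿ_ord(𝓤, M)) ≃+ Π_s Γ(M, X ∩ U_s)` the degree-`n` component of `Hom(𝒪_X, res)` is `(res c)_s = c_{e_s}|`.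
[cite: StacksProject, Tag 01FG] -/
theorem homTopAddEquiv_resOfFull (n : ℕ) (x : Ext.{w} (unitModule X) ((Cech.complex U M).X n) 0) :
    homTopAddEquiv U M n (((AcyclicResolution.extComplexMap (unitModule X) (resOfFull U M)).f n).hom x) =
      ((resOfFullObj U M n).app ⊤ (Cech.homTopAddEquiv U M n x) : Cech.Sections (faces U n) 0 M ⊤) := by
  obtain ⟨f, rfl⟩ : ∃ f : unitModule X ⟶ (Cech.complex U M).X n, Ext.mk₀ f = x :=
    ⟨Ext.homEquiv₀ x, Ext.mk₀_homEquiv₀_apply x⟩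
  rw [AcyclicResolution.extComplexMap_f_apply, Ext.mk₀_comp_mk₀, homTopAddEquiv_mk₀, Cech.homTopAddEquiv_mk₀,
    resOfFull_f, Scheme.Modules.Hom.comp_app, CategoryTheory.comp_apply]
  rfl

/-- **The restriction to increasing tuples is injective on Čech cohomology, elementwise**: for a finite cover `𝓤` of the
scheme `X` with affine finite intersections and an affine-localizing `𝒪_X`-module `M`, a full Čech `(n+1)`-cocycle
`c ∈ Π_{α : [n+1] → ι} Γ(M, U_α)` (`d c = 0`) whose restriction to the increasing tuples is an ordered coboundary
(`res c = d g`, `g ∈ Π_{#s = n+1} Γ(M, U_s)`) is a full coboundary: `c = d w`.  (The injectivity half of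
★ `homologyMap_resOfFull_bijective`, read through the `ker ⧸ Im` model of the homology of `Γ(X, Č•)`.)
[cite: StacksProject, Tag 01FM] [cite: StacksProject, Tag 01FG] -/
theorem exists_dSections_eq_of_resOfFull_eq_d
    (hU : ∀ {m : ℕ} (β : Fin (m + 1) → ι), IsAffineOpen (face U β))
    (hU' : ∀ s : Finset ι, s.Nonempty → IsAffineOpen (faceSet U s))
    (hcov : ⨆ i, U i = ⊤) (hM : IsAffineLocalizing M) (n : ℕ)
    (c : Cech.Sections U (n + 1) M ⊤) (hc : Cech.dSections U M (n + 1) ⊤ c = 0)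
    (g : Cech.Sections (faces U n) 0 M ⊤)
    (hg : ((resOfFullObj U M (n + 1)).app ⊤ c : Cech.Sections (faces U (n + 1)) 0 M ⊤) = (d U M n).app ⊤ g) :
    ∃ w : Cech.Sections U n M ⊤, Cech.dSections U M n ⊤ w = c := by
  -- the two complexes of abelian groups and the map between them
  set K := Cech.homComplex.{w} U M with hK
  set K' := homComplex.{w} U M with hK'
  set ψ : K ⟶ K' := AcyclicResolution.extComplexMap (unitModule X) (resOfFull U M) with hψ
  -- the cochain `c` and the ordered cochain `g` as elements of `K`, `K'`
  set x : K.X (n + 1) := (Cech.homTopAddEquiv U M (n + 1)).symm c with hx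
  set y : K'.X n := (homTopAddEquiv U M n).symm g with hy
  have hxc : Cech.homTopAddEquiv U M (n + 1) x = c := AddEquiv.apply_symm_apply _ c
  have hyg : homTopAddEquiv U M n y = g := AddEquiv.apply_symm_apply _ g
  -- `x` is a cocycle
  have hdx : (K.d (n + 1) (n + 2)).hom x = 0 := by
    apply (Cech.homTopAddEquiv U M (n + 2)).injective
    rw [Cech.homTopAddEquiv_d, hxc, hc]
    exact ((Cech.homTopAddEquiv U M (n + 2)).map_zero).symm
  -- `ψ x = d y`
  have hψx : (ψ.f (n + 1)).hom x = (K'.d n (n + 1)).hom y := by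
    apply (homTopAddEquiv U M (n + 1)).injective
    rw [homTopAddEquiv_resOfFull, hxc, hg, homTopAddEquiv_d, hyg]
  -- the `ker ⧸ Im` models
  let e := K.homologyIsoSc' n (n + 1) (n + 2) (CochainComplex.prev_nat_succ n) (CochainComplex.next ℕ (n + 1)) ≪≫
    ShortComplex.abHomologyIso _
  let e' := K'.homologyIsoSc' n (n + 1) (n + 2) (CochainComplex.prev_nat_succ n) (CochainComplex.next ℕ (n + 1)) ≪≫
    ShortComplex.abHomologyIso _
  have hconc := AcyclicResolution.homologyMap_concreteOf ψ n (n + 1) (n + 2) (CochainComplex.prev_nat_succ n)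
    (CochainComplex.next ℕ (n + 1))
  -- the class of `x`
  let xK : AddMonoidHom.ker (K.sc' n (n + 1) (n + 2)).g.hom := ⟨x, hdx⟩
  have hq0 : AcyclicResolution.kerQuotMapOf ψ n (n + 1) (n + 2) (QuotientAddGroup.mk xK) = 0 := by
    change QuotientAddGroup.mk (AcyclicResolution.kerMapOf ψ n (n + 1) (n + 2) xK) = (0 : _ ⧸ _)
    rw [QuotientAddGroup.eq_zero_iff]
    refine ⟨y, Subtype.ext ?_⟩
    rw [ShortComplex.abToCycles_apply_coe, AcyclicResolution.kerMapOf_apply_val]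
    exact hψx.symm
  -- injectivity of `H(ψ)` transported to the models
  have hinj : Function.Injective (HomologicalComplex.homologyMap ψ (n + 1)).hom :=
    (homologyMap_resOfFull_bijective.{w} U M hU hU' hcov hM n).1
  have hcl : e.inv.hom (QuotientAddGroup.mk xK) = 0 := by
    apply hinj
    rw [map_zero]
    have h1 : e'.hom.hom ((HomologicalComplex.homologyMap ψ (n + 1)).hom (e.inv.hom (QuotientAddGroup.mk xK))) = 0 := by
      change (HomologicalComplex.homologyMap ψ (n + 1) ≫ e'.hom).hom (e.inv.hom (QuotientAddGroup.mk xK)) = 0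
      rw [hconc]
      change AcyclicResolution.kerQuotMapOf ψ n (n + 1) (n + 2) ((e.inv ≫ e.hom).hom (QuotientAddGroup.mk xK)) = 0
      rw [Iso.inv_hom_id]
      exact hq0
    have h2 := congrArg e'.inv.hom h1
    rw [map_zero, ← CategoryTheory.comp_apply, Iso.hom_inv_id] at h2
    exact h2
  have hmk : (QuotientAddGroup.mk xK : _ ⧸ (K.sc' n (n + 1) (n + 2)).abToCycles.range) = 0 := by
    have h3 := congrArg e.hom.hom hcl
    rw [map_zero, ← CategoryTheory.comp_apply, Iso.inv_hom_id] at h3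
    exact h3
  rw [QuotientAddGroup.eq_zero_iff] at hmk
  obtain ⟨w', hw'⟩ := hmk
  have hxw : (K.d n (n + 1)).hom w' = x := by
    have := congrArg Subtype.val hw'
    rw [ShortComplex.abToCycles_apply_coe] at this
    exact this
  refine ⟨Cech.homTopAddEquiv U M n w', ?_⟩
  rw [← Cech.homTopAddEquiv_d, hxw, hxc]

end CechOrd

end Literature.AlgebraicGeometry.Modules

end
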